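import Literature.Computability.QuantumComplexity.CopyBlock
import Literature.Computability.QuantumComplexity.CircuitEmbedding
import Literature.Computability.QuantumComplexity.JonesSamplerMargins
import HarnessLib

/-!
# Many Hadamard-test copies on disjoint blocks: implementation and product statistics

Topic `Literature/Computability/QuantumComplexity`; a step in the discharge of
`ajl_jonesApproxProblem_mem_PromiseBQP` (AJL §3.3: repeat the Hadamard test `poly` times, half for the
real and half for the imaginary part, and average). `m` copies of the block circuit of
`CopyBlock.lean` placed on pairwise disjoint blocks `E j : Fin b ↪ Fin W` (`CircuitEmbedding.lean`):

* `copiesCircuit` and `copiesCircuit_implOn`: on inputs every block of which is clean and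
  table-consistent, the placed copies implement the product of the placed Hadamard-test operators
  up to `m · wordErr`;
* `copiesIdeal_mulVec_basisState`: the ideal product sends the input basis state to the product
  state of the block outputs (frame rule);
* `prob_pattern_prodState`: the Born weight of reading a pattern `γ` on the test qubits of a
  product state is the product of the block weights (`sum_normSq_prodState_mul`), and
  `prob_event_prodState` its sum over a set of patterns.

## References

* D. Aharonov, V. Jones, Z. Landau, Algorithmica 55 (2009), §3.3 [AharonovJonesLandau2009].
* M. A. Nielsen, I. L. Chuang, *Quantum Computation and Quantum Information*, CUP 2010, §2.2.8,
  §4.5.2 [NielsenChuang2010].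
-/

noncomputable section

namespace Literature.Computability.QuantumComplexity

open _root_.Matrix Finset Cryptography
open scoped Matrix.Norms.L2Operator

variable {b W m : ℕ}

/-! ### Placing a list of block operators -/

/-- The product of block operators placed on their blocks (list order). [folklore] -/
def placedProd (E : Fin m → (Fin b ↪ Fin W)) (T : Fin m → Matrix (QReg b) (QReg b) ℂ) : Matrix (QReg W) (QReg W) ℂ :=
  ((List.finRange m).map fun j => placeGate (E j) (T j)).prod

/-- The matrix of the copies placed by `mapWires`, as a product in reverse list order. [folklore] -/
theorem toMatrix_flatMap_mapWires (A : Language Bool) (E : Fin m → (Fin b ↪ Fin W)) (C : Fin m → QCircuit cliffordT b) :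
    ∀ l : List (Fin m), (⟨l.flatMap fun j => (mapWires (E j) (C j)).gates⟩ : QCircuit cliffordT W).toMatrix A =
      ((l.map fun j => placeGate (E j) ((C j).toMatrix A)).reverse).prod
  | [] => by simp
  | j :: l => by
    rw [List.flatMap_cons, show (⟨(mapWires (E j) (C j)).gates ++ l.flatMap fun j => (mapWires (E j) (C j)).gates⟩ : QCircuit cliffordT W) =
      (mapWires (E j) (C j)).append ⟨l.flatMap fun j => (mapWires (E j) (C j)).gates⟩ from rfl, QCircuit.toMatrix_append,
      toMatrix_flatMap_mapWires A E C l, toMatrix_mapWires, List.map_cons, List.reverse_cons, List.prod_append, List.prod_singleton]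

/-! ### The copies -/

section Copies

variable {E : Fin m → (Fin b ↪ Fin W)} (hE : BlockDisjoint E)

/-- **The circuit of the copies**: copy `j` (the block circuit `C j`) placed on block `E j`, the blocks
listed in reverse so that the matrix is `placedProd` in list order. [cite: AharonovJonesLandau2009, §3.3] -/
def copiesCircuit (E : Fin m → (Fin b ↪ Fin W)) (C : Fin m → QCircuit cliffordT b) : QCircuit cliffordT W :=
  ⟨(List.finRange m).reverse.flatMap fun j => (mapWires (E j) (C j)).gates⟩

/-- Its matrix. [folklore] -/
theorem copiesCircuit_toMatrix (A : Language Bool) (C : Fin m → QCircuit cliffordT b) :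
    (copiesCircuit E C).toMatrix A = placedProd E (fun j => (C j).toMatrix A) := by
  rw [copiesCircuit, toMatrix_flatMap_mapWires, List.map_reverse, List.reverse_reverse, placedProd]

/-- It is oracle-free when the copies are. [folklore] -/
theorem copiesCircuit_isOracleFree {C : Fin m → QCircuit cliffordT b} (hC : ∀ j, (C j).IsOracleFree) : (copiesCircuit E C).IsOracleFree := by
  intro g hg
  simp only [copiesCircuit, List.mem_flatMap, List.mem_reverse] at hg
  obtain ⟨j, -, hg⟩ := hg
  exact isOracleFree_mapWires (E j) (hC j) g hg

/-- The clean-input condition of the copies: every block in its copy condition. [folklore] -/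
def Pcopies (E : Fin m → (Fin b ↪ Fin W)) (P : Set (QReg b)) : Set (QReg W) := {x | ∀ j, x ∘ E j ∈ P}

include hE in
/-- A block operator placed on block `j` preserves the conditions of the other blocks, and of its own
block if it preserves the block condition. [folklore] -/
theorem preservesSupp_placeGate_Pcopies {P : Set (QReg b)} {T : Matrix (QReg b) (QReg b) ℂ} (hT : PreservesSupp P T) (j : Fin m) :
    PreservesSupp (Pcopies E P) (placeGate (E j) T) := by
  have e : Pcopies E P = ⋂ i, {x : QReg W | x ∘ E i ∈ P} := by ext x; simp [Pcopies]
  rw [e]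
  -- preserve each condition
  have hi : ∀ i, PreservesSupp {x : QReg W | x ∘ E i ∈ P} (placeGate (E j) T) := by
    intro i
    by_cases hij : i = j
    · subst hij; exact PreservesSupp.placeGate (E i) hT
    · refine preservesSupp_placeGate_of_offWires (E j) (fun x y hxy => ?_) T
      simp only [Set.mem_setOf_eq]
      have : x ∘ E i = y ∘ E i := funext fun t => hxy _ (fun hr => by
        obtain ⟨t', ht'⟩ := hr
        exact Set.disjoint_left.1 (hE i j hij) ⟨t, rfl⟩ ⟨t', ht'⟩)
      rw [this]
  intro ψ hψ x hx
  rw [Set.mem_iInter, not_forall] at hx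
  obtain ⟨i, hi'⟩ := hx
  exact hi i ψ (fun y hy => hψ y fun h => hy (Set.mem_iInter.1 h i)) x hi'

include hE in
/-- **The copies implement the product of the placed ideal block operators**, with the errors added.
[cite: AharonovJonesLandau2009, Claim 4.1 and Thm. 4.3] [cite: NielsenChuang2010, §4.5.3 eq. (4.63)] -/
theorem copiesCircuit_implOn {P : Set (QReg b)} {C : Fin m → QCircuit cliffordT b} {T : Fin m → Matrix (QReg b) (QReg b) ℂ} {δ : ℝ} (hδ : 0 ≤ δ)
    (hC : ∀ j, ImplOn P ((C j).toMatrix 0) (T j) δ) (hTu : ∀ j, T j ∈ Matrix.unitaryGroup (QReg b) ℂ) (hTP : ∀ j, PreservesSupp P (T j)) :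
    ImplOn (Pcopies E P) ((copiesCircuit E C).toMatrix 0) (placedProd E T) (m * δ) := by
  have h := ImplOn.listProd (P := Pcopies E P)
    (L := (List.finRange m).map fun j => (⟨placeGate (E j) ((C j).toMatrix 0), placeGate (E j) (T j), δ⟩ : ApproxStep W))
    (by
      intro s hs; rw [List.mem_map] at hs; obtain ⟨j, -, rfl⟩ := hs
      exact
        { implOn := ((hC j).placeGate (E j) hδ).of_subset fun x hx => hx j
          act_contr := isContraction_of_mem_unitaryGroup (placeGate_mem_unitaryGroup_holds _
            (QCircuit.toMatrix_mem_unitaryGroup_holds cliffordT_isUnitary_holds 0 _))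
          ideal_contr := isContraction_of_mem_unitaryGroup (placeGate_mem_unitaryGroup_holds _ (hTu j))
          ideal_pres := preservesSupp_placeGate_Pcopies hE (hTP j) j
          err_nonneg := hδ })
  simp only [List.map_map, Function.comp_def] at h
  rw [copiesCircuit_toMatrix, placedProd]
  have hsum : ((List.finRange m).map fun _ => δ).sum = m * δ := by rw [List.map_const', List.sum_replicate, nsmul_eq_mul, List.length_finRange]
  rw [← hsum]
  exact h

include hE in
/-- **The ideal product on a basis state is the product state of the block outputs** (frame rule).
[cite: NielsenChuang2010, §2.1.7 eq. (2.45)] -/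
theorem placedProd_mulVec_basisState (T : Fin m → Matrix (QReg b) (QReg b) ℂ) (x : QReg W) :
    placedProd E T *ᵥ basisState x = prodState E (fun j => T j *ᵥ basisState (x ∘ E j)) x := by
  rw [basisState_eq_prodState E x, placedProd]
  suffices h : ∀ l : List (Fin m), l.Nodup → ((l.map fun j => placeGate (E j) (T j)).prod) *ᵥ prodState E (fun j => basisState (x ∘ E j)) x =
      prodState E (fun j => if j ∈ l then T j *ᵥ basisState (x ∘ E j) else basisState (x ∘ E j)) x by
    have := h (List.finRange m) (List.nodup_finRange m); simpa using this
  intro l hl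
  induction l with
  | nil => simp
  | cons j l ih =>
    rw [List.map_cons, List.prod_cons, ← Matrix.mulVec_mulVec, ih (List.nodup_cons.1 hl).2, placeGate_mulVec_prodState hE]
    congr 1
    funext i
    by_cases hij : i = j
    · subst hij
      rw [Function.update_self, if_pos (List.mem_cons_self ..), if_neg (List.nodup_cons.1 hl).1]
    · rw [Function.update_of_ne hij]
      simp [hij]

end Copies

/-! ### Statistics of a product state on the test qubits -/

section ProdStats

variable {E : Fin m → (Fin b ↪ Fin W)} (hE : BlockDisjoint E) (q : Fin b)

/-- The block weight of reading `c` on the test qubit. [folklore] -/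
def blockWeight (φ : QReg b → ℂ) (c : Bool) : ℝ := ∑ y ∈ Finset.univ.filter (fun y : QReg b => y q = c), ‖φ y‖ ^ 2

include hE in
/-- **Born weight of a test-qubit pattern on a product state = product of block weights.**
[cite: NielsenChuang2010, §2.2.8] -/
theorem prob_pattern_prodState (φ : Fin m → QReg b → ℂ) (c : QReg W) (γ : Fin m → Bool) :
    (∑ z ∈ Finset.univ.filter (fun z : QReg W => ∀ j, z (E j q) = γ j), ‖prodState E φ c z‖ ^ 2) = ∏ j, blockWeight q (φ j) (γ j) := by
  classical
  rw [Finset.sum_filter]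
  have h := sum_normSq_prodState_mul hE φ c (fun y => if ∀ j, y j q = γ j then 1 else 0)
  simp only [mul_ite, mul_one, mul_zero] at h
  have e1 : ∀ z : QReg W, (if ∀ j, (z ∘ E j) q = γ j then ‖prodState E φ c z‖ ^ 2 else 0) = (if ∀ j, z (E j q) = γ j then ‖prodState E φ c z‖ ^ 2 else 0) :=
    fun z => rfl
  simp only [e1] at h
  rw [h]
  -- factor the sum over tuples
  rw [show (∑ y : Fin m → QReg b, if ∀ j, y j q = γ j then ∏ i, ‖φ i (y i)‖ ^ 2 else 0) =
      ∑ y : Fin m → QReg b, ∏ i, (if y i q = γ i then ‖φ i (y i)‖ ^ 2 else 0) from Finset.sum_congr rfl fun y _ => by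
        split_ifs with hy
        · exact Finset.prod_congr rfl fun i _ => by rw [if_pos (hy i)]
        · push Not at hy; obtain ⟨i, hi⟩ := hy
          exact (Finset.prod_eq_zero (Finset.mem_univ i) (by rw [if_neg hi])).symm]
  rw [← Fintype.prod_sum (fun i (y : QReg b) => if y q = γ i then ‖φ i y‖ ^ 2 else 0)]
  refine Finset.prod_congr rfl fun i _ => ?_
  rw [blockWeight, Finset.sum_filter]

include hE in
/-- Born weight of an event on the test qubits (a set of patterns). [cite: NielsenChuang2010, §2.2.8] -/
theorem prob_event_prodState (φ : Fin m → QReg b → ℂ) (c : QReg W) (A : Finset (Fin m → Bool)) :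
    (∑ z ∈ Finset.univ.filter (fun z : QReg W => (fun j => z (E j q)) ∈ A), ‖prodState E φ c z‖ ^ 2) =
      ∑ γ ∈ A, ∏ j, blockWeight q (φ j) (γ j) := by
  classical
  have e : (Finset.univ.filter fun z : QReg W => (fun j => z (E j q)) ∈ A) =
      A.biUnion (fun γ => Finset.univ.filter fun z : QReg W => ∀ j, z (E j q) = γ j) := by
    ext z
    simp only [Finset.mem_filter, Finset.mem_univ, true_and, Finset.mem_biUnion]
    constructor
    · intro h; exact ⟨_, h, fun j => rfl⟩
    · rintro ⟨γ, hγ, h⟩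
      have : (fun j => z (E j q)) = γ := funext h
      rw [this]; exact hγ
  rw [e, Finset.sum_biUnion]
  · exact Finset.sum_congr rfl fun γ _ => prob_pattern_prodState hE q φ c γ
  · intro γ _ γ' _ hne
    simp only [Function.onFun]
    rw [Finset.disjoint_left]
    intro z h1 h2
    simp only [Finset.mem_filter, Finset.mem_univ, true_and] at h1 h2
    exact hne (funext fun j => (h1 j).symm.trans (h2 j))

end ProdStats

/-! ### The AJL copies: block weights and the statistics of the placed copies -/

section AJL

variable {n r : ℕ} {Gb : WordGeom b n r} (hGb : Gb.OK) {E : Fin m → (Fin b ↪ Fin W)} (hE : BlockDisjoint E)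

/-- The complementary block weight: the two test-qubit outcomes of a state of norm one sum to one.
[folklore] -/
theorem blockWeight_true_eq (q : Fin b) {φ : QReg b → ℂ} (hφ : Cryptography.normSq φ = 1) :
    blockWeight q φ true = 1 - blockWeight q φ false := by
  have htot : blockWeight q φ true + blockWeight q φ false = 1 := by
    rw [blockWeight, blockWeight, ← hφ, Cryptography.normSq]
    rw [← Finset.sum_filter_add_sum_filter_not Finset.univ (fun y : QReg b => y q = true) (fun y => ‖φ y‖ ^ 2)]
    congr 1
    exact Finset.sum_congr (Finset.filter_congr fun y _ => by cases y q <;> simp) fun _ _ => rfl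
  linarith

/-- The ideal weight of outcome `c` of a trial of type `t` on the amplitude `z`: `(1 ± Re(s_t z))/2`.
[cite: AharonovJonesLandau2009, §2.2 and §3.3] -/
def idealWeight (z : ℂ) (t c : Bool) : ℝ := (1 + (if c then -1 else 1) * (phaseOf t * z).re) / 2

/-- `Re(phaseOf t · z)` is the real or the imaginary part. [folklore] -/
theorem re_phaseOf_mul (z : ℂ) (t : Bool) : (phaseOf t * z).re = if t then z.im else z.re := by
  unfold phaseOf; cases t <;> simp

/-- The ideal weight is the sampler's test probability. [cite: AharonovJonesLandau2009, §3.3] -/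
theorem idealWeight_eq_testProb (z : ℂ) (t c : Bool) : idealWeight z t c = AJLSampler.testProb z t c := by
  rw [idealWeight, AJLSampler.testProb, AJLSampler.sgn, re_phaseOf_mul]

include hGb in
/-- **The block weights of the ideal Hadamard-test operator** on a basis input with the test qubit
off: `idealWeight z₀ t c` with `z₀ = Q(b)_{pp}`, `p` the path-register content.
[cite: AharonovJonesLandau2009, §2.2 and §3.3] -/
theorem blockWeight_hadTestOp (β : Fin r → Option (Fin (n - 1) × Bool)) (t : Bool) {y₀ : QReg b} (hy : y₀ Gb.q = false) (c : Bool) :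
    blockWeight Gb.q (hadTestOp Gb.q (Gb.coreU β) (phaseOf t) *ᵥ basisState y₀) c =
      idealWeight (ajlPosCoreMatrix (WordGeom.wordOf β) (y₀ ∘ Gb.E) (y₀ ∘ Gb.E)) t c := by
  have hU := WordGeom.coreU_mem_unitaryGroup (G := Gb) β
  have hUq := WordGeom.coreU_apply_eq_zero hGb β
  have h0 : blockWeight Gb.q (hadTestOp Gb.q (Gb.coreU β) (phaseOf t) *ᵥ basisState y₀) false =
      (1 + (phaseOf t * ajlPosCoreMatrix (WordGeom.wordOf β) (y₀ ∘ Gb.E) (y₀ ∘ Gb.E)).re) / 2 := by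
    rw [blockWeight]
    have h := hadTestOp_prob Gb.q hU hUq hy (norm_phaseOf t)
    have e : Gb.coreU β (Function.update y₀ Gb.q true) (Function.update y₀ Gb.q true) = ajlPosCoreMatrix (WordGeom.wordOf β) (y₀ ∘ Gb.E) (y₀ ∘ Gb.E) := by
      rw [WordGeom.coreU, placeGate_apply, if_pos (fun _ _ => rfl)]
      have : Function.update y₀ Gb.q true ∘ Gb.E = y₀ ∘ Gb.E := funext fun j => Function.update_of_ne (fun hh => hGb.q_E ⟨j, hh⟩) ..
      rw [this]
    rw [e] at h
    convert h using 2
  cases c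
  · rw [h0, idealWeight]; simp
  · rw [blockWeight_true_eq Gb.q (by
      rw [normSq_mulVec_of_mem_unitaryGroup (hadTestOp_mem_unitaryGroup Gb.q hU hUq (norm_phaseOf t)), normSq_basisState]), h0, idealWeight]
    simp only [if_true]; ring

include hGb hE in
/-- **The statistics of the placed AJL copies.** Copy `j` runs the trial of type `ty j`; on a basis
input `x` every block of which holds the same clean, table-consistent content with the test qubit
off and path content `p`, the probability that the test qubits read a pattern in `A` is within
`m · wordErr` of `Σ_{γ ∈ A} ∏_j idealWeight z₀ (ty j) (γ j)`, `z₀ = Q(b)_{pp}`.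
[cite: AharonovJonesLandau2009, §3.3 and Thm. 4.3] -/
theorem copies_prob (β : Fin r → Option (Fin (n - 1) × Bool)) (ty : Fin m → Bool) {x : QReg W} (hx : ∀ j, x ∘ E j ∈ Gb.Pcopy β)
    (hq : ∀ j, x (E j Gb.q) = false) {p : QReg (2 * (n + 1))} (hp : ∀ j, (x ∘ E j) ∘ Gb.E = p) (A : Finset (Fin m → Bool)) :
    |(∑ z ∈ Finset.univ.filter (fun z : QReg W => (fun j => z (E j Gb.q)) ∈ A),
        ‖((copiesCircuit E fun j => WordGeom.copyCircuit hGb (ty j)).toMatrix 0 *ᵥ basisState x) z‖ ^ 2) -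
      ∑ γ ∈ A, ∏ j, idealWeight (ajlPosCoreMatrix (WordGeom.wordOf β) p p) (ty j) (γ j)| ≤ m * WordGeom.wordErr n r Gb.kit.k := by
  set T : Fin m → Matrix (QReg b) (QReg b) ℂ := fun j => hadTestOp Gb.q (Gb.coreU β) (phaseOf (ty j)) with hT
  have hU := WordGeom.coreU_mem_unitaryGroup (G := Gb) β
  have hUq := WordGeom.coreU_apply_eq_zero hGb β
  have hTu : ∀ j, T j ∈ Matrix.unitaryGroup (QReg b) ℂ := fun j => hadTestOp_mem_unitaryGroup Gb.q hU hUq (norm_phaseOf _)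
  have himpl := copiesCircuit_implOn hE (P := Gb.Pcopy β) (C := fun j => WordGeom.copyCircuit hGb (ty j)) (T := T)
    (by unfold WordGeom.wordErr GadgetKit.letterErr GadgetKit.rotErr GadgetKit.phaseErr; positivity)
    (fun j => WordGeom.copyCircuit_implOn hGb β (ty j)) hTu (fun j => WordGeom.preservesSupp_hadTestOp hGb β _)
  -- perturbation of the event probability
  have hPu : placedProd E T ∈ Matrix.unitaryGroup (QReg W) ℂ := by
    unfold placedProd
    exact Submonoid.list_prod_mem _ (by
      intro M hM; rw [List.mem_map] at hM; obtain ⟨j, -, rfl⟩ := hM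
      exact placeGate_mem_unitaryGroup_holds _ (hTu j))
  have hpert := abs_sum_normSq_sub_le_of_implOn (QCircuit.toMatrix_mem_unitaryGroup_holds cliffordT_isUnitary_holds 0 _) hPu
    himpl (ψ := basisState x) (fun y hy => by rw [basisState, Pi.single_apply, if_neg]; rintro rfl; exact hy hx) (normSq_basisState x)
    (Finset.univ.filter fun z : QReg W => (fun j => z (E j Gb.q)) ∈ A)
  -- the ideal statistics
  have hideal : (∑ z ∈ Finset.univ.filter (fun z : QReg W => (fun j => z (E j Gb.q)) ∈ A), ‖(placedProd E T *ᵥ basisState x) z‖ ^ 2) =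
      ∑ γ ∈ A, ∏ j, idealWeight (ajlPosCoreMatrix (WordGeom.wordOf β) p p) (ty j) (γ j) := by
    rw [placedProd_mulVec_basisState hE, prob_event_prodState hE]
    refine Finset.sum_congr rfl fun γ _ => Finset.prod_congr rfl fun j _ => ?_
    rw [hT, blockWeight_hadTestOp hGb β (ty j) (hq j), hp j]
  rw [hideal] at hpert
  exact hpert

end AJL

end Literature.Computability.QuantumComplexity

end
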